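import Summits.BirchSwinnertonDyer.Rank1Residual.X11a.SelmerCompanionResidueCertificateShapes
import HarnessLib

/-!
# Route (3e) SELMER COMPANION, XXVII: the booking shapes with an ABSTRACT agreement hypothesis
# (class X11a = N7; cell `b2b-bsdres`, unit `b2b-bsdres-x11a`, gen 30)

HONEST FRAMING (run/shared/lean/b2b/bsd-rank1-residual/, verbatim in every file): the goal of the
cell is to DELETE the COMBINATION-SHAPED residual classes of the Birch–Swinnerton-Dyer formula for
ALL analytic-rank `≤ 1` elliptic curves over `ℚ` — "full BSD formula for every rank `≤ 1` curve in
class `C`" assembled STRICTLY from published theorems — so that the rank-`≤ 1` remainder becomes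
exactly the CONSTRUCTION-SHAPED classes, which are TYPED (missing-input `Prop`s), NOT attempted.
This is not "finishing BSD". CLASS-OWNERS.md: research routes; NO CLAIM BEYOND STATED CLASSES.
THEOREMS ONLY; nothing booked; no label moves. CONDITIONAL on the PUBLISHED binders GZK (`hGZK`),
Cassels–Tate (`hCT`), Tate uniformisation (`hU2` = A41), Tate's local Euler characteristic
(`hEP`, Milne *ADT* I Thm. 2.8; discharged in the tree), and on the per-pair finite data named.

## What this file proves

The booking shapes of route (3e) (plain: file II/XII; D with an abstract killing place: file XVI;
E at the place `p`: file XX) so far list the admissible places of `S \ T` by SIX KINDS, each a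
disjunct of the hypothesis `hplaces` dispatched inside the proof to the per-kind lemma. Every new
kind (file XXVI: kinds (iv), (vi) at `ℓ = 2`; future kinds) would need a new dispatcher. This file
states the three shapes ONCE with the agreement at the places of `S \ T` as an ABSTRACT hypothesis

  `hagree : ∀ v ∈ S \ T, (v ∤ p ∧ E(ℚ_v)[p] = 0) ∨ θ_* 𝓢_v(E) ≤ 𝓢_v(A)`,

to be discharged per place by ANY kind lemma of the series (`h1Equiv_mem_selmerLocalKer_of_…`:
files I, IV, VIII, XI-b, XXVI) — the census cites the lemma used at each place:

* `bsdp_of_bsdp_partner_of_selmerCompanion_agree` — plain shape: `BSD(A,p)` for the closed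
  partner, budget `p^{r_an(A)} · ∏_T #E(ℚ_v)[p]·#(ℤ_v/p) ≤ p`;
* `bsdp_of_selmerCompanion_agree_kill` — shape D / mirror: a strict place `v₀` given by its
  effect `hkill` and the injectivity `hstrict` of `Sel^(p)(A) → H¹(ℚ_{v₀}, A[p])`, budget
  `∏_T ≤ p`, NO hypothesis on `A` beyond `hstrict`;
* `natCard_selmerGroup_le_of_agree_strict_at_p_rat`, `bsdp_of_selmerCompanion_agree_strict_at_p`
  — shape E: `v₀ = (p)`, `E` multiplicative and `A` good and strict at `p` (file XIX's `hstrict`),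
  budget `p · ∏_T ≤ p`.

The proofs are those of files XII / XVI / XX with the dispatcher replaced by `hagree` (tree counts
`natCard_selmerGroup_le_of_congr_of_le_off[_strict | _insert_strict]`). File XXVIII gives the
residue-certificate forms. Not a class theorem; nothing booked.

References: files I, II, XII, XIII, XVI, XIX, XX; [MazurRubin2004] §2.3; [Miller2011LMS] Def. 1.1;
HOME/b2b-bsdres-x11a/REPORT-g30.md.
-/

set_option autoImplicit false

noncomputable section

open scoped Classical NNReal

open WeierstrassCurve Literature.NumberTheory.EllipticCurves
  Literature.NumberTheory.GaloisRepresentations Field NumberField IsDedekindDomain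
  IsDedekindDomain.HeightOneSpectrum
  Literature.NumberTheory.EllipticCurves.Rank1Residual
  Literature.NumberTheory.EllipticCurves.Rank1Residual.Typed

namespace Summit.BirchSwinnertonDyer.Rank1Residual.X11a.SelmerCompanion

variable (W A : WeierstrassCurve ℚ) (p : ℕ) [hp : Fact p.Prime]

/-! ## §1 The plain shape -/

/-- **Plain shape with abstract agreement — `BSD(A,p) ⟹ BSD(E,p)`.** Let `p` be odd, `E = W`
globally minimal of analytic rank `0` with `E[p]` irreducible and `p ∤ #Ш_an(E)`; `A` globally
minimal and CLOSED at `p` (`BSD(A,p)`, `p ∤ #Ш_an(A)`); `θ : E[p] ≃ A[p]` a `Γ_ℚ`-isomorphism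
(certificate C1); `S ⊇ T` finite sets of places with both curves good and `v ∤ p` outside `S`;
at every `v ∈ S \ T` EITHER `v ∤ p` and `E(ℚ_v)[p] = 0` (kind (i)) OR the local conditions agree
along `θ`: `θ_* 𝓢_v(E) ≤ 𝓢_v(A)` (`hagree`, any kind lemma). If
`p^{r_an(A)} · ∏_{v∈T} #E(ℚ_v)[p]·#(ℤ_v/p) ≤ p` then `BSD(E,p)` (count of file I,
`#Sel^(p)(A) = p^{r_an(A)}` by file II, Cassels–Tate parity). Binders GZK, Cassels–Tate. Not a
class theorem; nothing booked. [cite: MazurRubin2004, §2.3] [cite: Miller2011LMS, §1 and Def. 1.1] -/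
theorem bsdp_of_bsdp_partner_of_selmerCompanion_agree [W.IsElliptic] [A.IsElliptic]
    (hGZK : rank_eq_analyticRank_of_analyticRank_le_one)
    (hCT : exists_casselsTate_pairing (K := ℚ)) (hp2 : p ≠ 2)
    (hr : W.analyticRank = 0) (hirr : Irr W p) (hSha : X11a.ShaAnUnit W p)
    (hbsdA : BSDp A p) (hShaA : X11a.ShaAnUnit A p)
    (θ : geomTorsion W (p : ℤ) ≃+ geomTorsion A (p : ℤ))
    (hθ : ∀ (σ : absoluteGaloisGroup ℚ) (P : geomTorsion W (p : ℤ)), θ (σ • P) = σ • θ P)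
    (S T : Finset (HeightOneSpectrum (𝓞 ℚ))) (hTS : T ⊆ S)
    (hS : ∀ v : HeightOneSpectrum (𝓞 ℚ), v ∉ S →
      A.HasGoodReductionAt v ∧ W.HasGoodReductionAt v ∧ (p : 𝓞 ℚ) ∉ v.asIdeal)
    (hagree : ∀ v ∈ S, v ∉ T →
      ((p : 𝓞 ℚ) ∉ v.asIdeal ∧ Nat.card (nsmulAddMonoidHom p :
          (W.baseChange (v.adicCompletion ℚ)).toAffine.Point →+ _).ker = 1) ∨
      (∀ c ∈ selmerLocalKer W (v.adicCompletion ℚ) (p : ℤ),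
        h1Equiv θ hθ c ∈ selmerLocalKer A (v.adicCompletion ℚ) (p : ℤ)))
    (hbudget : p ^ A.analyticRank *
        ∏ v ∈ T, (Nat.card (nsmulAddMonoidHom p :
            (W.baseChange (v.adicCompletion ℚ)).toAffine.Point →+ _).ker *
          Nat.card (v.adicCompletionIntegers ℚ ⧸
            Ideal.span {(p : v.adicCompletionIntegers ℚ)})) ≤ p) :
    BSDp W p := by
  have hpp : p.Prime := hp.out
  classical
  have hirrA : Irr A p := GreenbergVatsal2000.hasIrreducibleModPGaloisRep_of_torsionIso θ hθ hirr
  have hA := natCard_selmerGroup_eq_pow_of_bsdp A p hbsdA hShaA hirrA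
  -- enlarge `T` by the places of kind (i)
  set T' := T ∪ S.filter (fun v ↦ (p : 𝓞 ℚ) ∉ v.asIdeal ∧ Nat.card (nsmulAddMonoidHom p :
      (W.baseChange (v.adicCompletion ℚ)).toAffine.Point →+ _).ker = 1) with hT'
  have hT'S : T' ⊆ S := Finset.union_subset hTS (Finset.filter_subset _ _)
  have h1 := natCard_selmerGroup_le_of_congr_of_le_off A W hp2 θ hθ S T' hT'S hS
    (fun v hv hvT c hc ↦ ?_)
  · refine bsdp_of_natCard_selmerGroup_le W p hGZK hCT hr hirr hSha
      (h1.trans (le_trans (le_of_eq ?_) hbudget))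
    rw [hA]
    congr 1
    have hsplit : T' = T ∪ (S.filter (fun v ↦ (p : 𝓞 ℚ) ∉ v.asIdeal ∧ Nat.card (nsmulAddMonoidHom p :
      (W.baseChange (v.adicCompletion ℚ)).toAffine.Point →+ _).ker = 1) \ T) := by
      rw [hT', Finset.union_sdiff_self_eq_union]
    rw [hsplit, Finset.prod_union Finset.disjoint_sdiff,
      Finset.prod_eq_one (s := _ \ T) (fun v hv ↦ ?_), mul_one]
    · refine Finset.prod_congr rfl fun v _ ↦ ?_
      exact W.natCard_kummerLocalConditionAt_adicCompletion v hpp.ne_zero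
    · rw [Finset.mem_sdiff, Finset.mem_filter] at hv
      rw [W.natCard_kummerLocalConditionAt_adicCompletion v hpp.ne_zero, hv.1.2.2, one_mul,
        natCard_quot_adicCompletionIntegers_eq_one hv.1.2.1]
  · have hvT0 : v ∉ T := fun h ↦ hvT (Finset.mem_union_left _ h)
    rcases hagree v hv hvT0 with h1 | h2
    · exact absurd (Finset.mem_union_right _ (Finset.mem_filter.mpr ⟨hv, h1⟩)) hvT
    · exact h2 c hc

/-! ## §2 Shape D / mirror with an abstract killing place -/

/-- **Shape D / mirror with abstract agreement.** As `bsdp_of_selmerCompanion_kill_six_kinds`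
(file XVI: the strict place `v₀` is described by `hkill : ∀ c ∈ 𝓢_{v₀}(E), θ_* c ∈ 𝓢_{v₀}(A) →
res_{v₀}(θ_* c) = 0` and by the injectivity `hstrict` of `Sel^(p)(A) → H¹(ℚ_{v₀}, A[p])`), with the
six kinds REPLACED by `hagree` at the places of `S \ T` (kind (i) or `θ_* 𝓢_v(E) ≤ 𝓢_v(A)`).
Budget `∏_{v∈T} #E(ℚ_v)[p]·#(ℤ_v/p) ≤ p`; rank-`0` `E` with `E[p]` irreducible and
`p ∤ #Ш_an(E)`; no hypothesis on `A` beyond `hstrict`. Binders GZK, Cassels–Tate. Not a class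
theorem; nothing booked. [cite: MazurRubin2004, §2.3] [cite: Miller2011LMS, §1 and Def. 1.1] -/
theorem bsdp_of_selmerCompanion_agree_kill [W.IsElliptic] [A.IsElliptic]
    (hGZK : rank_eq_analyticRank_of_analyticRank_le_one)
    (hCT : exists_casselsTate_pairing (K := ℚ)) (hp2 : p ≠ 2)
    (hr : W.analyticRank = 0) (hirr : Irr W p) (hSha : X11a.ShaAnUnit W p)
    (θ : geomTorsion W (p : ℤ) ≃+ geomTorsion A (p : ℤ))
    (hθ : ∀ (σ : absoluteGaloisGroup ℚ) (P : geomTorsion W (p : ℤ)), θ (σ • P) = σ • θ P)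
    (S T : Finset (HeightOneSpectrum (𝓞 ℚ))) (hTS : T ⊆ S)
    (hS : ∀ v : HeightOneSpectrum (𝓞 ℚ), v ∉ S →
      A.HasGoodReductionAt v ∧ W.HasGoodReductionAt v ∧ (p : 𝓞 ℚ) ∉ v.asIdeal)
    (hagree : ∀ v ∈ S, v ∉ T →
      ((p : 𝓞 ℚ) ∉ v.asIdeal ∧ Nat.card (nsmulAddMonoidHom p :
          (W.baseChange (v.adicCompletion ℚ)).toAffine.Point →+ _).ker = 1) ∨
      (∀ c ∈ selmerLocalKer W (v.adicCompletion ℚ) (p : ℤ),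
        h1Equiv θ hθ c ∈ selmerLocalKer A (v.adicCompletion ℚ) (p : ℤ)))
    {v₀ : HeightOneSpectrum (𝓞 ℚ)}
    (hkill : ∀ c ∈ selmerLocalKer W (v₀.adicCompletion ℚ) (p : ℤ),
      h1Equiv θ hθ c ∈ selmerLocalKer A (v₀.adicCompletion ℚ) (p : ℤ) →
      galoisCohomology.res (A.torsionGaloisModule (p : ℤ)) (v₀.adicCompletion ℚ) 1
        (h1Equiv θ hθ c) = 0)
    (hstrict : ∀ d ∈ A.selmerGroup (p : ℤ),
      galoisCohomology.res (A.torsionGaloisModule (p : ℤ)) (v₀.adicCompletion ℚ) 1 d = 0 → d = 0)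
    (hbudget : ∏ v ∈ T, (Nat.card (nsmulAddMonoidHom p :
        (W.baseChange (v.adicCompletion ℚ)).toAffine.Point →+ _).ker *
          Nat.card (v.adicCompletionIntegers ℚ ⧸
            Ideal.span {(p : v.adicCompletionIntegers ℚ)})) ≤ p) :
    BSDp W p := by
  have hpp : p.Prime := hp.out
  classical
  -- strictness at `v₀` in the form of file XIII
  have hstrict' : ∀ c ∈ selmerLocalKer W (v₀.adicCompletion ℚ) (p : ℤ),
      h1Equiv θ hθ c ∈ A.selmerGroup (p : ℤ) → h1Equiv θ hθ c = 0 := by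
    intro c hc hcA
    exact hstrict _ hcA (hkill c hc (((mem_selmerGroup_iff A _ _).mp hcA).1 v₀))
  -- enlarge `T` by the places of kind (i), then the strict count of file XIII
  set T' := T ∪ S.filter (fun v ↦ (p : 𝓞 ℚ) ∉ v.asIdeal ∧ Nat.card (nsmulAddMonoidHom p :
      (W.baseChange (v.adicCompletion ℚ)).toAffine.Point →+ _).ker = 1) with hT'
  have hT'S : T' ⊆ S := Finset.union_subset hTS (Finset.filter_subset _ _)
  have h1 := natCard_selmerGroup_le_of_congr_of_le_off_strict A W hp2 θ hθ S T' hT'S hS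
    (fun v hv hvT c hc ↦ ?_) hstrict'
  · refine bsdp_of_natCard_selmerGroup_le W p hGZK hCT hr hirr hSha
      (h1.trans (le_trans (le_of_eq ?_) hbudget))
    have hsplit' : T' = T ∪ (S.filter (fun v ↦ (p : 𝓞 ℚ) ∉ v.asIdeal ∧ Nat.card (nsmulAddMonoidHom p :
      (W.baseChange (v.adicCompletion ℚ)).toAffine.Point →+ _).ker = 1) \ T) := by
      rw [hT', Finset.union_sdiff_self_eq_union]
    rw [hsplit', Finset.prod_union Finset.disjoint_sdiff,
      Finset.prod_eq_one (s := _ \ T) (fun v hv ↦ ?_), mul_one]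
    · refine Finset.prod_congr rfl fun v _ ↦ ?_
      exact W.natCard_kummerLocalConditionAt_adicCompletion v hpp.ne_zero
    · rw [Finset.mem_sdiff, Finset.mem_filter] at hv
      rw [W.natCard_kummerLocalConditionAt_adicCompletion v hpp.ne_zero, hv.1.2.2, one_mul,
        natCard_quot_adicCompletionIntegers_eq_one hv.1.2.1]
  · have hvT0 : v ∉ T := fun h ↦ hvT (Finset.mem_union_left _ h)
    rcases hagree v hv hvT0 with h1 | h2
    · exact absurd (Finset.mem_union_right _ (Finset.mem_filter.mpr ⟨hv, h1⟩)) hvT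
    · exact h2 c hc

/-! ## §3 Shape E (strict at the place of `p`) -/

variable [W.IsElliptic] [W.IsGloballyMinimal] [A.IsElliptic] [A.IsGloballyMinimal]

/-- **The strict count over `ℚ` at the place of `p`, with abstract agreement elsewhere.** As
`natCard_selmerGroup_le_of_six_kinds_strict_at_p_rat` (file XX), with the six kinds of the places
of `S \ (T ∪ {v₀})` REPLACED by `hagree`: `θ : E[p] ≃ A[p]`, `p` odd, `v₀ = (p) ∈ S \ T` with `E`
MULTIPLICATIVE and `A` GOOD and STRICT at `p` (`hstrict`, file XIX):
`#Sel^(p)(E/ℚ) ≤ p · ∏_{v∈T} #E(ℚ_v)[p]·#(ℤ_v/p)` (index `≤ p` at `v₀` by file XIX).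
[cite: MazurRubin2004, §2.3] [cite: GreenbergLNM1716, §2 Props. 2.2, 2.4]
[cite: MilneADT2006, Ch. I §2 Thm. 2.8] -/
theorem natCard_selmerGroup_le_of_agree_strict_at_p_rat
    (hU2 : Silverman1994_thmV53_corV54_tateUniformisation.{0})
    (hEP : ∀ v : HeightOneSpectrum (𝓞 ℚ), (p : 𝓞 ℚ) ∈ v.asIdeal →
      localEulerPoincareCharacteristic (v.adicCompletion ℚ)) (hp2 : p ≠ 2)
    (θ : geomTorsion W (p : ℤ) ≃+ geomTorsion A (p : ℤ))
    (hθ : ∀ (σ : absoluteGaloisGroup ℚ) (P : geomTorsion W (p : ℤ)), θ (σ • P) = σ • θ P)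
    (S T : Finset (HeightOneSpectrum (𝓞 ℚ))) (hTS : T ⊆ S)
    (hS : ∀ v : HeightOneSpectrum (𝓞 ℚ), v ∉ S →
      A.HasGoodReductionAt v ∧ W.HasGoodReductionAt v ∧ (p : 𝓞 ℚ) ∉ v.asIdeal)
    {v₀ : HeightOneSpectrum (𝓞 ℚ)} (hpv₀ : (p : 𝓞 ℚ) ∈ v₀.asIdeal) (hv₀S : v₀ ∈ S) (hv₀T : v₀ ∉ T)
    (hmult : W.HasMultiplicativeReductionAtPrime p) (hA₀ : A.HasGoodReductionAtPrime p)
    (hagree : ∀ v ∈ S, v ∉ T → v ≠ v₀ →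
      ((p : 𝓞 ℚ) ∉ v.asIdeal ∧ Nat.card (nsmulAddMonoidHom p :
          (W.baseChange (v.adicCompletion ℚ)).toAffine.Point →+ _).ker = 1) ∨
      (∀ c ∈ selmerLocalKer W (v.adicCompletion ℚ) (p : ℤ),
        h1Equiv θ hθ c ∈ selmerLocalKer A (v.adicCompletion ℚ) (p : ℤ)))
    {w : Valuation (AlgebraicClosure (v₀.adicCompletion ℚ)) ℝ≥0}
    (hw : ∀ x, (w x : ℝ) =
      spectralNorm (v₀.adicCompletion ℚ) (AlgebraicClosure (v₀.adicCompletion ℚ)) x)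
    [hV : (A.baseChange (AlgebraicClosure (v₀.adicCompletion ℚ))).IsIntegral w.integer]
    (hstrict : ∀ ψ : contOneCocycles (discreteTopRep (absoluteGaloisGroup ℚ) (geomTorsion A (p : ℤ))),
      oneCocycleClass _ ψ ∈ A.selmerGroup (p : ℤ) →
      ∀ b : localPoints A (v₀.adicCompletion ℚ),
        (∀ σ : absoluteGaloisGroup (v₀.adicCompletion ℚ), pointsMap A (v₀.adicCompletion ℚ)
          ((ψ.1 (resGal (K := ℚ) (v₀.adicCompletion ℚ) σ) : geomTorsion A (p : ℤ)) : geomPoints A)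
            = σ • b - b) →
        (∀ σ : absoluteGaloisGroup (v₀.adicCompletion ℚ),
          ((σ • b - b : localPoints A (v₀.adicCompletion ℚ)) :
            (A.baseChange (AlgebraicClosure (v₀.adicCompletion ℚ))).toAffine.Point) ∈
            FormalGroupChart.kernel w (A.baseChange (AlgebraicClosure (v₀.adicCompletion ℚ)))) →
        oneCocycleClass _ ψ = 0) :
    Nat.card (W.selmerGroup (p : ℤ)) ≤
      p * ∏ v ∈ T, (Nat.card (nsmulAddMonoidHom p :
          (W.baseChange (v.adicCompletion ℚ)).toAffine.Point →+ _).ker *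
        Nat.card (v.adicCompletionIntegers ℚ ⧸ Ideal.span {(p : v.adicCompletionIntegers ℚ)})) := by
  have hpp : p.Prime := hp.out
  classical
  -- enlarge `T` by the places of kind (i) (they cost `#𝓛_v = 1`)
  set T' := T ∪ S.filter (fun v ↦ (p : 𝓞 ℚ) ∉ v.asIdeal ∧ Nat.card (nsmulAddMonoidHom p :
      (W.baseChange (v.adicCompletion ℚ)).toAffine.Point →+ _).ker = 1) with hT'
  have hT'S : T' ⊆ S := Finset.union_subset hTS (Finset.filter_subset _ _)
  have hv₀T' : v₀ ∉ T' := by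
    rw [hT', Finset.mem_union, Finset.mem_filter, not_or]
    exact ⟨hv₀T, fun h ↦ h.2.1 hpv₀⟩
  have h1 := natCard_selmerGroup_le_of_congr_of_le_off_insert_strict A W hp2 θ hθ S T' hv₀S hv₀T'
    hT'S hS (fun v hv hvT hvv₀ c hc ↦ ?_)
    (relIndex_map_selmerLocalKer_le_of_mult_of_good_at_p W A p hU2 hp2 θ hθ hpv₀ (hEP v₀ hpv₀)
      hmult hA₀)
    (fun c hc hsel ↦ h1Equiv_eq_zero_of_selmer_of_strict_at_p W A p hU2 hp2 θ hθ hpv₀ hmult hA₀ hw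
      hstrict hc hsel)
  · refine h1.trans (le_of_eq ?_)
    congr 1
    have hsplit' : T' = T ∪ (S.filter (fun v ↦ (p : 𝓞 ℚ) ∉ v.asIdeal ∧ Nat.card (nsmulAddMonoidHom p :
      (W.baseChange (v.adicCompletion ℚ)).toAffine.Point →+ _).ker = 1) \ T) := by
      rw [hT', Finset.union_sdiff_self_eq_union]
    rw [hsplit', Finset.prod_union Finset.disjoint_sdiff,
      Finset.prod_eq_one (s := _ \ T) (fun v hv ↦ ?_), mul_one]
    · refine Finset.prod_congr rfl fun v _ ↦ ?_
      exact W.natCard_kummerLocalConditionAt_adicCompletion v hpp.ne_zero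
    · rw [Finset.mem_sdiff, Finset.mem_filter] at hv
      rw [W.natCard_kummerLocalConditionAt_adicCompletion v hpp.ne_zero, hv.1.2.2, one_mul,
        natCard_quot_adicCompletionIntegers_eq_one hv.1.2.1]
  · have hvT0 : v ∉ T := fun h ↦ hvT (Finset.mem_union_left _ h)
    rcases hagree v hv hvT0 hvv₀ with h1 | h2
    · exact absurd (Finset.mem_union_right _ (Finset.mem_filter.mpr ⟨hv, h1⟩)) hvT
    · exact h2 c hc

/-- **Shape E with abstract agreement.** As `bsdp_of_selmerCompanion_strict_at_p_six_kinds`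
(file XX), with the six kinds REPLACED by `hagree` at the places of `S \ (T ∪ {v₀})`: `E = W`
globally minimal, rank `0`, `E[p]` irreducible, `p ∤ #Ш_an(E)`, MULTIPLICATIVE at `p`; `A`
globally minimal, GOOD and STRICT at `p` (file XIX's `hstrict`); `θ : E[p] ≃ A[p]`; budget
`p · ∏_{v∈T} #E(ℚ_v)[p]·#(ℤ_v/p) ≤ p`. Then `BSD(E,p)`. NO hypothesis `BSD(A,p)`, no rank
condition on `A`, no main conjecture. Binders GZK, Cassels–Tate, A41, Milne I.2.8. Not a class
theorem; nothing booked. [cite: MazurRubin2004, §2.3] [cite: Miller2011LMS, §1 and Def. 1.1]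
[cite: GreenbergLNM1716, §2 Props. 2.2, 2.4] [cite: MilneADT2006, Ch. I §2 Thm. 2.8] -/
theorem bsdp_of_selmerCompanion_agree_strict_at_p
    (hU2 : Silverman1994_thmV53_corV54_tateUniformisation.{0})
    (hEP : ∀ v : HeightOneSpectrum (𝓞 ℚ), (p : 𝓞 ℚ) ∈ v.asIdeal →
      localEulerPoincareCharacteristic (v.adicCompletion ℚ))
    (hGZK : rank_eq_analyticRank_of_analyticRank_le_one)
    (hCT : exists_casselsTate_pairing (K := ℚ)) (hp2 : p ≠ 2)
    (hr : W.analyticRank = 0) (hirr : Irr W p) (hSha : X11a.ShaAnUnit W p)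
    (θ : geomTorsion W (p : ℤ) ≃+ geomTorsion A (p : ℤ))
    (hθ : ∀ (σ : absoluteGaloisGroup ℚ) (P : geomTorsion W (p : ℤ)), θ (σ • P) = σ • θ P)
    (S T : Finset (HeightOneSpectrum (𝓞 ℚ))) (hTS : T ⊆ S)
    (hS : ∀ v : HeightOneSpectrum (𝓞 ℚ), v ∉ S →
      A.HasGoodReductionAt v ∧ W.HasGoodReductionAt v ∧ (p : 𝓞 ℚ) ∉ v.asIdeal)
    {v₀ : HeightOneSpectrum (𝓞 ℚ)} (hpv₀ : (p : 𝓞 ℚ) ∈ v₀.asIdeal) (hv₀S : v₀ ∈ S) (hv₀T : v₀ ∉ T)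
    (hmult : W.HasMultiplicativeReductionAtPrime p) (hA₀ : A.HasGoodReductionAtPrime p)
    (hagree : ∀ v ∈ S, v ∉ T → v ≠ v₀ →
      ((p : 𝓞 ℚ) ∉ v.asIdeal ∧ Nat.card (nsmulAddMonoidHom p :
          (W.baseChange (v.adicCompletion ℚ)).toAffine.Point →+ _).ker = 1) ∨
      (∀ c ∈ selmerLocalKer W (v.adicCompletion ℚ) (p : ℤ),
        h1Equiv θ hθ c ∈ selmerLocalKer A (v.adicCompletion ℚ) (p : ℤ)))
    {w : Valuation (AlgebraicClosure (v₀.adicCompletion ℚ)) ℝ≥0}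
    (hw : ∀ x, (w x : ℝ) =
      spectralNorm (v₀.adicCompletion ℚ) (AlgebraicClosure (v₀.adicCompletion ℚ)) x)
    [hV : (A.baseChange (AlgebraicClosure (v₀.adicCompletion ℚ))).IsIntegral w.integer]
    (hstrict : ∀ ψ : contOneCocycles (discreteTopRep (absoluteGaloisGroup ℚ) (geomTorsion A (p : ℤ))),
      oneCocycleClass _ ψ ∈ A.selmerGroup (p : ℤ) →
      ∀ b : localPoints A (v₀.adicCompletion ℚ),
        (∀ σ : absoluteGaloisGroup (v₀.adicCompletion ℚ), pointsMap A (v₀.adicCompletion ℚ)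
          ((ψ.1 (resGal (K := ℚ) (v₀.adicCompletion ℚ) σ) : geomTorsion A (p : ℤ)) : geomPoints A)
            = σ • b - b) →
        (∀ σ : absoluteGaloisGroup (v₀.adicCompletion ℚ),
          ((σ • b - b : localPoints A (v₀.adicCompletion ℚ)) :
            (A.baseChange (AlgebraicClosure (v₀.adicCompletion ℚ))).toAffine.Point) ∈
            FormalGroupChart.kernel w (A.baseChange (AlgebraicClosure (v₀.adicCompletion ℚ)))) →
        oneCocycleClass _ ψ = 0)
    (hbudget : p * ∏ v ∈ T, (Nat.card (nsmulAddMonoidHom p :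
        (W.baseChange (v.adicCompletion ℚ)).toAffine.Point →+ _).ker *
          Nat.card (v.adicCompletionIntegers ℚ ⧸
            Ideal.span {(p : v.adicCompletionIntegers ℚ)})) ≤ p) :
    BSDp W p := by
  have hle := natCard_selmerGroup_le_of_agree_strict_at_p_rat W A p hU2 hEP hp2 θ hθ S T hTS hS hpv₀
    hv₀S hv₀T hmult hA₀ hagree hw hstrict
  exact bsdp_of_natCard_selmerGroup_le W p hGZK hCT hr hirr hSha (hle.trans hbudget)

end Summit.BirchSwinnertonDyer.Rank1Residual.X11a.SelmerCompanion

end
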